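import Literature.Computation.Certificates.Data
import Literature.Computation.Certificates.PosSemidef
import Literature.Computation.Certificates.PosSemidefInt
import Mathlib.Data.List.GetD
import HarnessLib

/-!
# Streaming residual check for integer Gram certificates (`A − FᵀF` by outer products over row lists)

Cell `turb-bounds` (pub-turb), T12 tooling of the shear lane (pub-turb-shear gen 4, 2026-08-21).

The audited predicate `PSD.IsGramCertZ A d B` (`Literature/Computation/Certificates/PosSemidefInt.lean`) says
that the integer residual `A − Bᵀ·diag d·B` is symmetric diagonally dominant; `decide +kernel` evaluates it ENTRY BY
ENTRY, i.e. `n²·m` sums `∑ k, d k * (B k i * B k j)`, each term paying two positional lookups of `B` (measured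
2026-08-21: ≈ 62·(n/58)^3.5 s per block with tree carriers, so blocks beyond `n ≈ 100` do not fit the farm cap).
This file computes the SAME residual (unit weights) by STREAMING over the factor rows — `A − FᵀF = A − Σ_k F_k F_kᵀ`,
one `List.zipWith` pass per nonzero factor entry — and proves, once, that the list computation agrees with
`PSD.gramResidualZ`; the row test `rowDominant` (`0 ≤ Rᵢᵢ ∧ Σ_j |Rᵢⱼ| ≤ 2·Rᵢᵢ`) then yields exactly the row
inequality of `PSD.IsDiagDominantZ`. Soundness therefore still rests on `IsGramCertZ.posSemidef[_of_smul]`; nothing in this file is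
trusted beyond the kernel — every statement below is proved without `sorry`/`native_decide`; what reviewers should read
are the five Boolean/list DEFINITIONS and the statements of the packaging theorems `rows_dominant_of_stream`,
`symm_of_transposeRows`, `cast_matrixOfRows_num`, `isGramCertZ_of_stream[']`. Row blocks (`forall_fin_of_blocks`) work as before: forcing rows `lo ≤ i < hi` of
`residualRows` forces only those rows of every layer (entry `(i,j)` of layer `k` depends on entry `(i,j)` of layer
`k−1` alone), so each block is its own `decide +kernel` with its own kernel cache.

API (namespace `Summit.NavierStokesRegularity.TurbBounds.GramStream`):
* `subOuter r acc`, `residualRows rowsA rowsF` (the list computation), `rowDominant i row`, `wellShaped n rowsA rowsF`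
  (Boolean tests, closed by `decide +kernel`);
* `getD_getD_residualRows` (list residual, entrywise, = `A i j − Σ_k F k i * F k j`),
  `rows_dominant_of_stream` (per row: `rowDominant` ⇒ the `IsDiagDominantZ` row inequality for
  `PSD.gramResidualZ (matrixOfRows n n rowsA) 1 (matrixOfRows m n rowsF)`),
  `isGramCertZ_of_stream` (symmetry of `A` + all rows ⇒ `PSD.IsGramCertZ`);
* list-level tests without positional lookups: `transposeRows` / `symm_of_transposeRows` (symmetry from
  `rows = transposeRows n rows`, `O(n²)`), `intRows` / `cast_matrixOfRows_num` (integer copy of rational rows),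
  `isGramCertZ_of_stream'` (shape + transpose test + rows ⇒ `PSD.IsGramCertZ`).
HONEST FRAMING: rigorous bounds for the stated PDE and boundary conditions; no claim about physical turbulence beyond
the bound.
-/

namespace Summit.NavierStokesRegularity.TurbBounds.GramStream

open Literature.Computation.Certificates Finset

/-! ### The list computation (evaluated by `decide +kernel`) -/

/-- Subtract the outer product `r·rᵀ` from an accumulator given by row lists; a zero entry `rᵢ = 0` leaves row `i`
untouched (shared), so the cost is `(#nonzeros of r)·n`. -/
def subOuter (r : List ℤ) (acc : List (List ℤ)) : List (List ℤ) :=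
  List.zipWith (fun ri row => if ri = 0 then row else List.zipWith (fun a rj => a - ri * rj) row r) r acc

/-- The residual rows `A − Σ_k F_k F_kᵀ = A − FᵀF` (factor rows folded over the rows of `A`). -/
def residualRows (rowsA rowsF : List (List ℤ)) : List (List ℤ) :=
  rowsF.foldr subOuter rowsA

/-- Row test (Boolean): nonnegative diagonal entry and `Σ_j |rowⱼ| ≤ 2·rowᵢ` (⇔ `Σ_{j ≠ i} |rowⱼ| ≤ rowᵢ`). -/
def rowDominant (i : ℕ) (row : List ℤ) : Bool :=
  decide (0 ≤ row.getD i 0) && decide ((row.map fun x => |x|).sum ≤ 2 * row.getD i 0)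

/-- Shape test (Boolean): `A` has `n` rows of length `n`, every factor row has length `n`. -/
def wellShaped (n : ℕ) (rowsA rowsF : List (List ℤ)) : Bool :=
  decide (rowsA.length = n) && decide (∀ i < n, (rowsA.getD i []).length = n) && decide (∀ r ∈ rowsF, r.length = n)

/-! ### Entrywise semantics of the list computation -/

/-- Positional reading of `List.zipWith` inside both lists. -/
theorem getD_zipWith {α β γ : Type*} (f : α → β → γ) (da : α) (db : β) (dc : γ) :
    ∀ (l : List α) (l' : List β) (i : ℕ), i < l.length → i < l'.length →
      (List.zipWith f l l').getD i dc = f (l.getD i da) (l'.getD i db)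
  | [], _, i, h1, _ => absurd h1 (Nat.not_lt_zero i)
  | _ :: _, [], i, _, h2 => absurd h2 (Nat.not_lt_zero i)
  | a :: as, b :: bs, 0, _, _ => rfl
  | a :: as, b :: bs, i + 1, h1, h2 => by
      simp only [List.zipWith_cons_cons, List.getD_cons_succ]
      exact getD_zipWith f da db dc as bs i (by simpa using h1) (by simpa using h2)

/-- Length of row `i` of `subOuter r acc` (rows keep their length `n`). -/
theorem length_getD_subOuter {n : ℕ} (r : List ℤ) (acc : List (List ℤ)) (hr : r.length = n)
    (hacc : acc.length = n) (hrow : ∀ i < n, (acc.getD i []).length = n) (i : ℕ) (hi : i < n) :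
    ((subOuter r acc).getD i []).length = n := by
  unfold subOuter
  rw [getD_zipWith _ (0 : ℤ) ([] : List ℤ) ([] : List ℤ) r acc i (hr ▸ hi) (hacc ▸ hi)]
  split
  · exact hrow i hi
  · rw [List.length_zipWith, hrow i hi, hr, Nat.min_self]

/-- Number of rows of `subOuter r acc`. -/
theorem length_subOuter {n : ℕ} (r : List ℤ) (acc : List (List ℤ)) (hr : r.length = n) (hacc : acc.length = n) :
    (subOuter r acc).length = n := by
  unfold subOuter
  rw [List.length_zipWith, hr, hacc, Nat.min_self]

/-- Entry `(i, j)` of `subOuter r acc` is `accᵢⱼ − rᵢ·rⱼ`. -/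
theorem getD_getD_subOuter {n : ℕ} (r : List ℤ) (acc : List (List ℤ)) (hr : r.length = n)
    (hacc : acc.length = n) (hrow : ∀ i < n, (acc.getD i []).length = n) (i j : ℕ) (hi : i < n) (hj : j < n) :
    ((subOuter r acc).getD i []).getD j 0 = (acc.getD i []).getD j 0 - r.getD i 0 * r.getD j 0 := by
  unfold subOuter
  rw [getD_zipWith _ (0 : ℤ) ([] : List ℤ) ([] : List ℤ) r acc i (hr ▸ hi) (hacc ▸ hi)]
  split
  · next h0 => rw [h0, zero_mul, sub_zero]
  · rw [getD_zipWith _ (0 : ℤ) (0 : ℤ) (0 : ℤ) (acc.getD i []) r j ((hrow i hi).symm ▸ hj) (hr ▸ hj)]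

/-- Shape of `residualRows`: `n` rows of length `n`. -/
theorem shape_residualRows {n : ℕ} (rowsA : List (List ℤ)) (hA : rowsA.length = n)
    (hAr : ∀ i < n, (rowsA.getD i []).length = n) :
    ∀ (rowsF : List (List ℤ)), (∀ r ∈ rowsF, r.length = n) →
      (residualRows rowsA rowsF).length = n ∧ ∀ i < n, ((residualRows rowsA rowsF).getD i []).length = n
  | [], _ => ⟨hA, hAr⟩
  | r :: rs, hF => by
      have hr : r.length = n := hF r (by simp)
      have ih := shape_residualRows rowsA hA hAr rs (fun x hx => hF x (by simp [hx]))
      refine ⟨?_, fun i hi => ?_⟩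
      · exact length_subOuter r _ hr ih.1
      · exact length_getD_subOuter r _ hr ih.1 ih.2 i hi

/-- **Entrywise semantics of the streamed residual**: for `i, j < n`,
`(residualRows A F)ᵢⱼ = Aᵢⱼ − Σ_k Fₖᵢ·Fₖⱼ` (positional readings with default `0`). -/
theorem getD_getD_residualRows {n : ℕ} (rowsA : List (List ℤ)) (hA : rowsA.length = n)
    (hAr : ∀ i < n, (rowsA.getD i []).length = n) :
    ∀ (rowsF : List (List ℤ)), (∀ r ∈ rowsF, r.length = n) → ∀ i j : ℕ, i < n → j < n →
      ((residualRows rowsA rowsF).getD i []).getD j 0 =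
        (rowsA.getD i []).getD j 0 - ∑ k : Fin rowsF.length, (rowsF.getD k.val []).getD i 0 * (rowsF.getD k.val []).getD j 0
  | [], _, i, j, _, _ => by simp [residualRows]
  | r :: rs, hF, i, j, hi, hj => by
      have hr : r.length = n := hF r (by simp)
      have hF' : ∀ x ∈ rs, x.length = n := fun x hx => hF x (by simp [hx])
      have ih := getD_getD_residualRows rowsA hA hAr rs hF' i j hi hj
      have sh := shape_residualRows rowsA hA hAr rs hF'
      have step : residualRows rowsA (r :: rs) = subOuter r (residualRows rowsA rs) := rfl
      rw [step, getD_getD_subOuter r _ hr sh.1 sh.2 i j hi hj, ih]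
      simp only [List.length_cons, Fin.sum_univ_succ, Fin.val_zero, List.getD_cons_zero, Fin.val_succ,
        List.getD_cons_succ]
      ring

/-! ### From the row test to the `IsDiagDominantZ` row inequality -/

/-- A `Fin`-indexed sum of positional readings of a list of the right length is the list sum. -/
theorem sum_fin_getD_eq_sum_map (g : ℤ → ℤ) : ∀ (row : List ℤ),
    ∑ j : Fin row.length, g (row.getD j.val 0) = (row.map g).sum
  | [] => by simp
  | a :: as => by
      rw [List.length_cons, Fin.sum_univ_succ, List.map_cons, List.sum_cons]
      simp only [Fin.val_zero, List.getD_cons_zero, Fin.val_succ, List.getD_cons_succ]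
      rw [sum_fin_getD_eq_sum_map g as]

/-- **Soundness of the streamed row test.** If `A`, `F` are well-shaped and row `i` of the streamed residual passes
`rowDominant`, then row `i` of `PSD.gramResidualZ (matrixOfRows n n A) 1 (matrixOfRows m n F)` satisfies the
diagonal-dominance inequality of `PSD.IsDiagDominantZ`. -/
theorem rows_dominant_of_stream {n : ℕ} {rowsA rowsF : List (List ℤ)} (hw : wellShaped n rowsA rowsF = true)
    (i : Fin n) (h : rowDominant i.val ((residualRows rowsA rowsF).getD i.val []) = true) :
    ∑ j ∈ Finset.univ.erase i,
        |PSD.gramResidualZ (matrixOfRows n n rowsA) (fun _ : Fin rowsF.length => 1)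
          (matrixOfRows rowsF.length n rowsF) i j| ≤
      PSD.gramResidualZ (matrixOfRows n n rowsA) (fun _ : Fin rowsF.length => 1)
        (matrixOfRows rowsF.length n rowsF) i i := by
  simp only [wellShaped, Bool.and_eq_true, decide_eq_true_eq] at hw
  obtain ⟨⟨hA, hAr⟩, hF⟩ := hw
  set row := (residualRows rowsA rowsF).getD i.val [] with hrow_def
  have hlen : row.length = n := (shape_residualRows rowsA hA hAr rowsF hF).2 i.val i.isLt
  -- the `gramResidualZ` entries of row `i` are the positional readings of `row`
  have hentry : ∀ j : Fin n, PSD.gramResidualZ (matrixOfRows n n rowsA) (fun _ : Fin rowsF.length => 1)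
      (matrixOfRows rowsF.length n rowsF) i j = row.getD j.val 0 := by
    intro j
    rw [hrow_def, getD_getD_residualRows rowsA hA hAr rowsF hF i.val j.val i.isLt j.isLt]
    simp only [PSD.gramResidualZ, matrixOfRows_apply, Nat.cast_one, one_mul]
  simp only [rowDominant, Bool.and_eq_true, decide_eq_true_eq] at h
  obtain ⟨hdiag, hsum⟩ := h
  -- total absolute row sum as a `Fin n` sum
  have htot : ∑ j : Fin n, |row.getD j.val 0| = (row.map fun x => |x|).sum := by
    have e := sum_fin_getD_eq_sum_map (fun x => |x|) row
    rw [hlen] at e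
    exact e
  have hsplit := Finset.add_sum_erase Finset.univ (fun j : Fin n => |row.getD j.val 0|) (Finset.mem_univ i)
  simp_rw [hentry]
  rw [abs_of_nonneg hdiag] at hsplit
  linarith

/-- **Integer Gram certificate from the streamed residual**: `A` symmetric (an `n²` check), every row of the streamed
residual `rowDominant` (the cheap pass, typically in row blocks via `forall_fin_of_blocks`). -/
theorem isGramCertZ_of_stream {n : ℕ} {rowsA rowsF : List (List ℤ)} (hw : wellShaped n rowsA rowsF = true)
    (hA : ∀ i j : Fin n, matrixOfRows n n rowsA i j = matrixOfRows n n rowsA j i)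
    (hr : ∀ i : Fin n, rowDominant i.val ((residualRows rowsA rowsF).getD i.val []) = true) :
    PSD.IsGramCertZ (matrixOfRows n n rowsA) (fun _ : Fin rowsF.length => 1) (matrixOfRows rowsF.length n rowsF) := by
  refine PSD.IsDiagDominantZ.intro (fun i j => ?_) fun i => rows_dominant_of_stream hw i (hr i)
  show matrixOfRows n n rowsA i j - _ = matrixOfRows n n rowsA j i - _
  rw [hA i j]
  congr 1
  exact Finset.sum_congr rfl fun k _ => by ring


/-! ### List-level symmetry and integrality tests (no positional lookups) -/

/-- Transpose of the first `n` columns by one `List.zipWith` pass per row (`O(n²)` cells). -/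
def transposeRows (n : ℕ) (rows : List (List ℤ)) : List (List ℤ) :=
  rows.foldr (fun r acc => List.zipWith List.cons r acc) (List.replicate n [])

/-- Shape and entries of `transposeRows`: `n` rows, and entry `(j, i)` is entry `(i, j)` of the input. -/
theorem transposeRows_spec (n : ℕ) : ∀ (rows : List (List ℤ)), (∀ r ∈ rows, r.length = n) →
    (transposeRows n rows).length = n ∧
      ∀ i j : ℕ, j < n → ((transposeRows n rows).getD j []).getD i 0 = (rows.getD i []).getD j 0
  | [], _ => ⟨by simp [transposeRows], fun i j hj => by
      simp [transposeRows, List.getD_eq_getElem?_getD, hj]⟩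
  | r :: rs, hF => by
      have hr : r.length = n := hF r (by simp)
      obtain ⟨hlen, hget⟩ := transposeRows_spec n rs (fun x hx => hF x (by simp [hx]))
      have step : transposeRows n (r :: rs) = List.zipWith List.cons r (transposeRows n rs) := rfl
      refine ⟨by rw [step, List.length_zipWith, hr, hlen, Nat.min_self], fun i j hj => ?_⟩
      have h1 : j < r.length := by rw [hr]; exact hj
      have h2 : j < (transposeRows n rs).length := by rw [hlen]; exact hj
      rw [step, getD_zipWith List.cons (0 : ℤ) ([] : List ℤ) ([] : List ℤ) r (transposeRows n rs) j h1 h2]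
      cases i with
      | zero => simp
      | succ i => simp only [List.getD_cons_succ]; exact hget i j hj

/-- **Symmetry from the list test** `rows = transposeRows n rows` (decided by the kernel in `O(n²)`). -/
theorem symm_of_transposeRows {n : ℕ} {rows : List (List ℤ)} (hF : ∀ r ∈ rows, r.length = n)
    (e : rows = transposeRows n rows) (i j : Fin n) :
    matrixOfRows n n rows i j = matrixOfRows n n rows j i := by
  simp only [matrixOfRows_apply]
  have h := (transposeRows_spec n rows hF).2 j.val i.val i.isLt
  rw [← e] at h
  exact h

/-- Integrality test (Boolean): every listed entry of the rational rows has denominator `1`. -/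
def intRows (rows : List (List ℚ)) : Bool :=
  rows.all fun r => r.all fun q => decide (q.den = 1)

/-- **Integer copy of rational rows**: if every entry is an integer, the `Rat.num` rows cast back to the rational
matrix (entrywise, with the factor `1` expected by `PSD.IsGramCertZ.posSemidef_of_smul`). -/
theorem cast_matrixOfRows_num {m n : ℕ} {rows : List (List ℚ)} (h : intRows rows = true) (i : Fin m) (j : Fin n) :
    ((matrixOfRows m n (rows.map (List.map Rat.num)) i j : ℤ) : ℚ) = 1 * matrixOfRows m n rows i j := by
  simp only [matrixOfRows_apply, one_mul]
  rw [show ([] : List ℤ) = List.map Rat.num ([] : List ℚ) from rfl, List.getD_map,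
    show (0 : ℤ) = Rat.num 0 from rfl, List.getD_map]
  set q := (rows.getD i.val []).getD j.val 0 with hq
  -- `q` is either a listed entry (denominator `1` by `h`) or a default `0`
  have hden : q.den = 1 := by
    simp only [intRows, List.all_eq_true, decide_eq_true_eq] at h
    by_cases hi : i.val < rows.length
    · have hrow : rows.getD i.val [] ∈ rows := by
        rw [List.getD_eq_getElem _ _ hi]; exact List.getElem_mem hi
      by_cases hj : j.val < (rows.getD i.val []).length
      · have hmem : q ∈ rows.getD i.val [] := by
          rw [hq, List.getD_eq_getElem _ _ hj]; exact List.getElem_mem hj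
        exact h _ hrow _ hmem
      · rw [hq, List.getD_eq_default _ _ (Nat.le_of_not_lt hj)]; rfl
    · rw [hq, List.getD_eq_default _ _ (Nat.le_of_not_lt hi)]; rfl
  exact Rat.coe_int_num_of_den_eq_one hden

/-- **Integer Gram certificate from the streamed residual, list tests only**: shape, symmetry by `transposeRows`,
every streamed residual row `rowDominant`. -/
theorem isGramCertZ_of_stream' {n : ℕ} {rowsA rowsF : List (List ℤ)} (hw : wellShaped n rowsA rowsF = true)
    (hT : rowsA = transposeRows n rowsA)
    (hr : ∀ i : Fin n, rowDominant i.val ((residualRows rowsA rowsF).getD i.val []) = true) :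
    PSD.IsGramCertZ (matrixOfRows n n rowsA) (fun _ : Fin rowsF.length => 1) (matrixOfRows rowsF.length n rowsF) := by
  have hw' := hw
  simp only [wellShaped, Bool.and_eq_true, decide_eq_true_eq] at hw'
  obtain ⟨⟨hA, hAr⟩, _⟩ := hw'
  have hF : ∀ r ∈ rowsA, r.length = n := by
    intro r hr'
    obtain ⟨i, hi, rfl⟩ := List.getElem_of_mem hr'
    have := hAr i (hA ▸ hi)
    rwa [List.getD_eq_getElem _ _ hi] at this
  exact isGramCertZ_of_stream hw (symm_of_transposeRows hF hT) hr

/-! ### Tests (kernel-checked) -/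

/-- Test: the `3 × 3` second-difference matrix with factor rows `(1,-1,0)`, `(0,1,-1)`: residual `diag(1,0,1)`,
every row dominant, certificate assembled. -/
example : PSD.IsGramCertZ (matrixOfRows 3 3 [[2, -1, 0], [-1, 2, -1], [0, -1, 2]]) (fun _ : Fin 2 => 1)
    (matrixOfRows 2 3 [[1, -1, 0], [0, 1, -1]]) :=
  isGramCertZ_of_stream (rowsA := [[2, -1, 0], [-1, 2, -1], [0, -1, 2]]) (rowsF := [[1, -1, 0], [0, 1, -1]])
    (by decide +kernel) (by decide +kernel) (by decide +kernel)

/-- Test: the streamed residual itself (`A − FᵀF = diag(1,0,1)` here). -/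
example : residualRows [[2, -1, 0], [-1, 2, -1], [0, -1, 2]] [[1, -1, 0], [0, 1, -1]] =
    [[1, 0, 0], [0, 0, 0], [0, 0, 1]] := by decide +kernel

/-- Test: the list-only assembly (`transposeRows` symmetry test). -/
example : PSD.IsGramCertZ (matrixOfRows 3 3 [[2, -1, 0], [-1, 2, -1], [0, -1, 2]]) (fun _ : Fin 2 => 1)
    (matrixOfRows 2 3 [[1, -1, 0], [0, 1, -1]]) :=
  isGramCertZ_of_stream' (rowsA := [[2, -1, 0], [-1, 2, -1], [0, -1, 2]]) (rowsF := [[1, -1, 0], [0, 1, -1]])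
    (by decide +kernel) (by decide +kernel) (by decide +kernel)

/-- Test: integer copy of rational rows with integer entries. -/
example : ∀ i j : Fin 2, ((matrixOfRows 2 2 (([[3, -4], [-4, 7]] : List (List ℚ)).map (List.map Rat.num)) i j : ℤ) : ℚ)
    = 1 * matrixOfRows 2 2 ([[3, -4], [-4, 7]] : List (List ℚ)) i j :=
  cast_matrixOfRows_num (by decide +kernel)

end Summit.NavierStokesRegularity.TurbBounds.GramStream
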